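import Literature.Barriers.CriticalPhenomena.PositionSpaceRGNonGibbsianCore
import Literature.Probability.LatticeModels.LeeYangRadii
import HarnessLib

/-!
# van Enter–Fernández–Sokal 1993, §4.3.1 Step 2.2 at ALL internal sites, part 1: the grading of
# the diluted lattice `ℤ^d ∖ 2ℤ^d` by the number of odd coordinates, and the threshold radii

Companion of `PositionSpaceRGNonGibbsianCore.lean` (uniqueness for the all-`+` image system at
the FIELD sites, GHS route) towards uniqueness at EVERY internal site, the content of Step 2.2
("The system `⟨R;∞;+⟩` has a unique Gibbs measure … in fact the Gibbs measure is unique at all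
temperatures", p. 110) that the printed text obtains from "Lee–Yang + Lebowitz–Penrose ⇒ the
pressure is jointly analytic in `J` and `h`" — an argument only sketched there ("it can be
shown") and not covered by Lebowitz–Penrose 1968 as printed (their low-activity expansion needs
the field at ALL sites, while here it acts only on the sites adjacent to image spins). The route
formalised in this line of files replaces it by a UNIFORM Lee–Yang zero-free disc in an extra
activity at all internal sites (`…LeeYang.lean`), whose combinatorial input is prepared here:

* `siteType x = #{i : xᵢ odd}` — the TYPE of a site (`0` = image/decimated site; the field sites
  of `Core.perInd` are the type-`1` sites, `perInd_eq_one_of_siteType_eq_one`); a unit step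
  changes the type by `±1` (`siteType_add_single`), so the internal lattice is graded with bonds
  only between consecutive types, and a type-`k` site has exactly `2k` neighbours of type `k-1`
  (`downNbrs`, `card_downNbrs`) and `2(d-k)` of type `k+1` (`upNbrs`, `card_upNbrs`).
* `TypeLower x y := siteType x < siteType y` — the orientation of the bonds (exactly one per bond,
  `typeLower_iff_not`).
* The THRESHOLD RADII `thrR a d k ∈ [a, 1)` (`a = e^{-2β}`), boosts
  `LeeYangRadii.boost a (thrR a d (k-1))`, level radii `thrRad a d k > 1` (`one_lt_thrRad`) and
  their minimum `thrMin a d > 1` (`one_lt_thrMin`), built by Bernoulli's inequality so that at a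
  type-`k` site the product of the `2k` incoming boosts beats the `2(d-k)` outgoing factors
  `thrR a d k` with room `thrRad a d k` to spare, while `a ≤ thrR` and `a · boost ≤ 1`
  (`mul_boost_thrR_le_one`) let missing neighbours (frozen `+` outside the volume) be absorbed.

All statements are proved; no named facts.

## References

* A. C. D. van Enter, R. Fernández, A. D. Sokal, J. Stat. Phys. 72 (1993) 879–1167
  (arXiv:hep-lat/9210032), §4.1.2 Step 1 and §4.3.1 Step 2.2 [VanenterFernandezSokal1993].
* T. D. Lee, C. N. Yang, Phys. Rev. 87 (1952) 410–419, Appendix II [LeeYang1952].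
* D. Ruelle, Phys. Rev. Lett. 26 (1971) 303–304 (extension of the circle theorem).
-/

noncomputable section

namespace Literature.Barriers.CriticalPhenomena.NonGibbs

open Finset Literature.Probability.LatticeModels Literature.Probability.LatticeModels.LeeYangRadii

variable {d : ℕ}

/-! ### The type of a site -/

/-- **The type of a site of `ℤ^d`**: its number of odd coordinates (`0` for the image sites
`2ℤ^d`, `1` for the internal sites adjacent to image spins, …; van Enter–Fernández–Sokal §4.1.2
Step 1: "an internal spin with all but one of its coordinates even — that is, one which is
adjacent to two image spins"). [cite: VanenterFernandezSokal1993, §4.1.2 Step 1] -/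
def siteType (x : Site d) : ℕ := (univ.filter fun i => ¬ (2 : ℤ) ∣ x i).card

/-- `siteType x ≤ d`. [folklore] -/
theorem siteType_le (x : Site d) : siteType x ≤ d :=
  (Finset.card_filter_le _ _).trans (by simp)

/-- The number of even coordinates is `d - siteType x`. [folklore] -/
theorem card_filter_even (x : Site d) :
    (univ.filter fun i => (2 : ℤ) ∣ x i).card = d - siteType x := by
  have h := Finset.card_filter_add_card_filter_not (s := (univ : Finset (Fin d)))
    (fun i => (2 : ℤ) ∣ x i)
  simp only [Finset.card_univ, Fintype.card_fin] at h
  unfold siteType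
  omega

/-- Image (decimated) sites are the sites of type `0`. [cite: VanenterFernandezSokal1993, §3.1.2 eq. (3.7)] -/
theorem isDecimatedSite_iff_siteType_eq_zero (x : Site d) :
    IsDecimatedSite d x ↔ siteType x = 0 := by
  unfold siteType IsDecimatedSite
  rw [Finset.card_eq_zero, Finset.filter_eq_empty_iff]
  simp

/-- Internal sites have type `≥ 1`. [cite: VanenterFernandezSokal1993, §4.1.2 Step 1] -/
theorem one_le_siteType_of_not_isDecimatedSite {x : Site d} (hx : ¬ IsDecimatedSite d x) :
    1 ≤ siteType x := by
  rw [isDecimatedSite_iff_siteType_eq_zero] at hx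
  omega

/-- **A unit step changes the type by one**: `siteType (x ± eᵢ) = siteType x + 1` if `xᵢ` is
even and `siteType x - 1` if `xᵢ` is odd. [cite: VanenterFernandezSokal1993, §4.1.2 Step 1] -/
theorem siteType_add_single (x : Site d) (i : Fin d) {s : ℤ} (hs : s = 1 ∨ s = -1) :
    siteType (x + Pi.single i s) = if (2 : ℤ) ∣ x i then siteType x + 1 else siteType x - 1 := by
  unfold siteType
  set O : Finset (Fin d) := univ.filter fun j => ¬ (2 : ℤ) ∣ x j with hO
  have hflip : (2 : ℤ) ∣ x i + s ↔ ¬ (2 : ℤ) ∣ x i := by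
    rcases hs with rfl | rfl <;> omega
  have hset : (univ.filter fun j => ¬ (2 : ℤ) ∣ (x + Pi.single i s : Site d) j) =
      if (2 : ℤ) ∣ x i then insert i O else O.erase i := by
    ext j
    by_cases hji : j = i
    · subst hji
      have hval : (x + Pi.single j s : Site d) j = x j + s := by simp
      split_ifs with h
      · rw [Finset.mem_filter, Finset.mem_insert, hval]
        exact ⟨fun _ => Or.inl rfl, fun _ => ⟨Finset.mem_univ _, hflip.not.2 (not_not.2 h)⟩⟩
      · rw [Finset.mem_filter, Finset.mem_erase, hval]
        exact ⟨fun h' => absurd (hflip.2 h) h'.2, fun h' => absurd rfl h'.1⟩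
    · have hval : (x + Pi.single i s : Site d) j = x j := by simp [Pi.single_eq_of_ne hji]
      split_ifs with h
      · rw [Finset.mem_filter, Finset.mem_insert, hval, hO, Finset.mem_filter]
        exact ⟨fun h' => Or.inr h', fun h' => h'.resolve_left hji⟩
      · rw [Finset.mem_filter, Finset.mem_erase, hval, hO, Finset.mem_filter]
        exact ⟨fun h' => ⟨hji, h'⟩, fun h' => h'.2⟩
  rw [hset]
  split_ifs with h
  · have hi : i ∉ O := by
      rw [hO, Finset.mem_filter]
      exact fun hi => hi.2 h
    rw [Finset.card_insert_of_notMem hi]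
  · have hi : i ∈ O := by
      rw [hO, Finset.mem_filter]
      exact ⟨Finset.mem_univ _, h⟩
    rw [Finset.card_erase_of_mem hi]

/-- The types of adjacent sites differ by one. [cite: VanenterFernandezSokal1993, §4.1.2 Step 1] -/
theorem siteType_of_adj {x y : Site d} (h : (zdGraph d).Adj x y) :
    siteType y = siteType x + 1 ∨ siteType y + 1 = siteType x := by
  obtain ⟨i, hi | hi⟩ := (zdGraph_adj_iff x y).1 h
  · rw [hi, siteType_add_single x i (Or.inl rfl)]
    split_ifs with h2
    · exact Or.inl rfl
    · right
      have : 1 ≤ siteType x := Finset.card_pos.2 ⟨i, Finset.mem_filter.2 ⟨Finset.mem_univ _, h2⟩⟩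
      omega
  · have hy : y = x + Pi.single i (-1) := by
      rw [hi, add_assoc, ← Pi.single_add]; simp
    rw [hy, siteType_add_single x i (Or.inr rfl)]
    split_ifs with h2
    · exact Or.inl rfl
    · right
      have : 1 ≤ siteType x := Finset.card_pos.2 ⟨i, Finset.mem_filter.2 ⟨Finset.mem_univ _, h2⟩⟩
      omega

/-! ### The orientation of the bonds by type -/

/-- The bond orientation: `x` is the lower end of `{x,y}` if its type is smaller.
[cite: VanenterFernandezSokal1993, §4.1.2 Step 1] -/
def TypeLower (x y : Site d) : Prop := siteType x < siteType y

/-- Decidability of the orientation. [folklore] -/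
instance : DecidableRel (TypeLower (d := d)) := fun x y =>
  inferInstanceAs (Decidable (siteType x < siteType y))

/-- Exactly one orientation per bond of `ℤ^d`. [cite: VanenterFernandezSokal1993, §4.1.2 Step 1] -/
theorem typeLower_iff_not {x y : Site d} (h : (zdGraph d).Adj x y) :
    TypeLower x y ↔ ¬ TypeLower y x := by
  unfold TypeLower
  rcases siteType_of_adj h with h1 | h1 <;> omega

/-- Exactly one orientation per bond of the diluted graph. [cite: VanenterFernandezSokal1993, §4.3.1 Step 1] -/
theorem typeLower_iff_not_diluted (x y : Site d) (h : (dilutedGraph d).Adj x y) :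
    TypeLower x y ↔ ¬ TypeLower y x :=
  typeLower_iff_not h.1

/-- The upper end of an oriented bond has type one more. [cite: VanenterFernandezSokal1993, §4.1.2 Step 1] -/
theorem siteType_eq_of_typeLower {x y : Site d} (h : (zdGraph d).Adj x y) (hl : TypeLower x y) :
    siteType y = siteType x + 1 := by
  unfold TypeLower at hl
  rcases siteType_of_adj h with h1 | h1 <;> omega

/-! ### Up- and down-neighbours -/

/-- The signed unit step `x ↦ x ± eᵢ` indexed by `Fin d × Bool`. [cite: FriedliVelenik2017, §3.1] -/
def step (x : Site d) (p : Fin d × Bool) : Site d := x + Pi.single p.1 (if p.2 then 1 else -1)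

/-- The step map is injective. [folklore] -/
theorem step_injective (x : Site d) : Function.Injective (step x) := fun _ _ h =>
  single_signedUnit_injective (add_left_cancel h)

/-- A step is a neighbour. [cite: FriedliVelenik2017, §3.1] -/
theorem adj_step (x : Site d) (p : Fin d × Bool) : (zdGraph d).Adj x (step x p) := by
  have : step x p ∈ (zdGraph d).neighborFinset x := by
    rw [neighborFinset_zdGraph_eq_image]
    exact Finset.mem_image.2 ⟨p, Finset.mem_univ _, rfl⟩
  exact (SimpleGraph.mem_neighborFinset _ _ _).1 this

/-- Every neighbour is a step. [cite: FriedliVelenik2017, §3.1] -/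
theorem exists_step_of_adj {x y : Site d} (h : (zdGraph d).Adj x y) : ∃ p, y = step x p := by
  have : y ∈ (zdGraph d).neighborFinset x := (SimpleGraph.mem_neighborFinset _ _ _).2 h
  rw [neighborFinset_zdGraph_eq_image] at this
  obtain ⟨p, -, hp⟩ := Finset.mem_image.1 this
  exact ⟨p, hp.symm⟩

/-- The type after a step. [cite: VanenterFernandezSokal1993, §4.1.2 Step 1] -/
theorem siteType_step (x : Site d) (p : Fin d × Bool) :
    siteType (step x p) = if (2 : ℤ) ∣ x p.1 then siteType x + 1 else siteType x - 1 :=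
  siteType_add_single x p.1 (by cases p.2 <;> simp)

/-- **The up-neighbours** of `x`: the `2(d - siteType x)` sites `x ± eᵢ`, `xᵢ` even (type one
more). [cite: VanenterFernandezSokal1993, §4.1.2 Step 1] -/
def upNbrs (x : Site d) : Finset (Site d) :=
  ((univ.filter fun i => (2 : ℤ) ∣ x i) ×ˢ (univ : Finset Bool)).image (step x)

/-- **The down-neighbours** of `x`: the `2 siteType x` sites `x ± eᵢ`, `xᵢ` odd (type one less;
for a type-`1` site these are its two image neighbours). [cite: VanenterFernandezSokal1993, §4.1.2 Step 1] -/
def downNbrs (x : Site d) : Finset (Site d) :=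
  ((univ.filter fun i => ¬ (2 : ℤ) ∣ x i) ×ˢ (univ : Finset Bool)).image (step x)

/-- `#upNbrs x = 2(d - siteType x)`. [cite: VanenterFernandezSokal1993, §4.1.2 Step 1] -/
theorem card_upNbrs (x : Site d) : (upNbrs x).card = 2 * (d - siteType x) := by
  unfold upNbrs
  rw [Finset.card_image_of_injective _ (step_injective x), Finset.card_product, card_filter_even,
    Finset.card_univ, Fintype.card_bool, mul_comm]

/-- `#downNbrs x = 2 siteType x`. [cite: VanenterFernandezSokal1993, §4.1.2 Step 1] -/
theorem card_downNbrs (x : Site d) : (downNbrs x).card = 2 * siteType x := by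
  unfold downNbrs
  rw [Finset.card_image_of_injective _ (step_injective x), Finset.card_product, Finset.card_univ,
    Fintype.card_bool, mul_comm]
  rfl

/-- A neighbour of type one more is an up-neighbour. [cite: VanenterFernandezSokal1993, §4.1.2 Step 1] -/
theorem mem_upNbrs_of_adj {x y : Site d} (h : (zdGraph d).Adj x y) (ht : siteType y = siteType x + 1) :
    y ∈ upNbrs x := by
  obtain ⟨p, rfl⟩ := exists_step_of_adj h
  rw [siteType_step] at ht
  have hp : (2 : ℤ) ∣ x p.1 := by
    by_contra hne
    rw [if_neg hne] at ht
    omega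
  exact Finset.mem_image.2 ⟨p, Finset.mem_product.2 ⟨by simp [hp], Finset.mem_univ _⟩, rfl⟩

/-- A down-neighbour is a neighbour of type one less. [cite: VanenterFernandezSokal1993, §4.1.2 Step 1] -/
theorem adj_and_siteType_of_mem_downNbrs {x y : Site d} (hy : y ∈ downNbrs x) :
    (zdGraph d).Adj x y ∧ siteType y + 1 = siteType x := by
  obtain ⟨p, hp, rfl⟩ := Finset.mem_image.1 hy
  have hodd : ¬ (2 : ℤ) ∣ x p.1 := by simpa using (Finset.mem_product.1 hp).1
  refine ⟨adj_step x p, ?_⟩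
  rw [siteType_step, if_neg hodd]
  have : 1 ≤ siteType x := Finset.card_pos.2 ⟨p.1, Finset.mem_filter.2 ⟨Finset.mem_univ _, hodd⟩⟩
  omega

/-- Down-neighbours of a site of type `≥ 2` are internal. [cite: VanenterFernandezSokal1993, §4.1.2 Step 1] -/
theorem not_isDecimatedSite_of_mem_downNbrs {x y : Site d} (hx : 2 ≤ siteType x)
    (hy : y ∈ downNbrs x) : ¬ IsDecimatedSite d y := by
  rw [isDecimatedSite_iff_siteType_eq_zero]
  have := (adj_and_siteType_of_mem_downNbrs hy).2
  omega

/-- **Type-`1` sites are field sites**: they have an image neighbour (`x + eᵢ` for the odd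
coordinate `i`), so `perInd d x = 1` ("adjacent to two image spins").
[cite: VanenterFernandezSokal1993, §4.1.2 Step 1] -/
theorem perInd_eq_one_of_siteType_eq_one {x : Site d} (hx : siteType x = 1) : perInd d x = 1 := by
  obtain ⟨i, hi⟩ := Finset.card_eq_one.1 hx
  have hodd : ¬ (2 : ℤ) ∣ x i := by
    have : i ∈ (univ.filter fun j => ¬ (2 : ℤ) ∣ x j) := by rw [hi]; exact Finset.mem_singleton_self i
    simpa using this
  have heven : ∀ j, j ≠ i → (2 : ℤ) ∣ x j := by
    intro j hj
    by_contra hne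
    have : j ∈ (univ.filter fun j => ¬ (2 : ℤ) ∣ x j) := Finset.mem_filter.2 ⟨Finset.mem_univ _, hne⟩
    rw [hi, Finset.mem_singleton] at this
    exact hj this
  have hdec : IsDecimatedSite d (x + Pi.single i 1) := by
    intro j
    by_cases hj : j = i
    · subst hj
      simp only [Pi.add_apply, Pi.single_eq_same]
      omega
    · simp only [Pi.add_apply, Pi.single_eq_of_ne hj, add_zero]
      exact heven j hj
  have hmem : x + Pi.single i 1 ∈ decNbrs d x :=
    (mem_decNbrs d).2 ⟨(zdGraph_adj_iff _ _).2 ⟨i, Or.inl rfl⟩, hdec⟩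
  unfold perInd
  rw [if_pos ⟨_, hmem⟩]

/-! ### The threshold radii -/

/-- **Bernoulli threshold.** For `B > 1`, `n ≥ 1` and `r ≥ 1 - (1 - B⁻¹)/(2n)`:
`B rⁿ > 1` (since `(1-η)ⁿ ≥ 1 - nη = (1 + B⁻¹)/2`, `η ≤ 1/2`). [folklore] -/
theorem one_lt_mul_pow_of_bernoulli {B r : ℝ} (hB : 1 < B) {n : ℕ} (hn : 1 ≤ n)
    (hr : 1 - (1 - B⁻¹) / (2 * n) ≤ r) : 1 < B * r ^ n := by
  have hB0 : 0 < B := by linarith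
  have hBinv : B⁻¹ < 1 := inv_lt_one_of_one_lt₀ hB
  have hBinv0 : 0 < B⁻¹ := inv_pos.2 hB0
  have hn0 : (0 : ℝ) < n := by exact_mod_cast hn
  set η : ℝ := (1 - B⁻¹) / (2 * n) with hη
  have hη0 : 0 ≤ η := div_nonneg (by linarith) (by positivity)
  have hn1 : (1 : ℝ) ≤ n := by exact_mod_cast hn
  have hη1 : η ≤ 1 / 2 := by
    rw [hη, div_le_div_iff₀ (by positivity) (by norm_num)]
    nlinarith
  have hbern : 1 + (n : ℝ) * (-η) ≤ (1 + (-η)) ^ n := one_add_mul_le_pow (by linarith) n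
  have hpow : (1 - η) ^ n ≤ r ^ n := pow_le_pow_left₀ (by linarith) (by linarith) n
  have hval : 1 + (n : ℝ) * (-η) = (1 + B⁻¹) / 2 := by
    rw [hη]; field_simp; ring
  have hkey : (1 + B⁻¹) / 2 ≤ r ^ n := by
    have : (1 + (-η)) ^ n = (1 - η) ^ n := by ring
    linarith [hbern, hpow]
  calc (1 : ℝ) < (B + 1) / 2 := by linarith
    _ = B * ((1 + B⁻¹) / 2) := by field_simp
    _ ≤ B * r ^ n := mul_le_mul_of_nonneg_left hkey hB0.le

/-- **The threshold radii** `thrR a d k` of the type-`k` sites (`a = e^{-2β}`): level `1` beats the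
field activity `a²` (`B = a⁻²`), level `k ≥ 2` beats with the boosts gained from level `k-1`
(`B = boost^{2k}`); each is `max a (1 - (1 - B⁻¹)/(2·2(d-k)))` (and `1` where no constraint
applies). [cite: LeeYang1952, Appendix II] -/
def thrR (a : ℝ) (d : ℕ) : ℕ → ℝ
  | 0 => 1
  | 1 => max a (1 - (1 - ((a ^ 2)⁻¹)⁻¹) / (2 * (2 * ((d - 1 : ℕ) : ℝ))))
  | k + 2 => max a (1 - (1 - (boost a (thrR a d (k + 1)) ^ (2 * (k + 2)))⁻¹) /
      (2 * (2 * ((d - (k + 2) : ℕ) : ℝ))))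

/-- The level gains `B_k`: `a⁻²` at level `1`, `boost(a, thrR (k-1))^{2k}` at level `k ≥ 2`.
[cite: LeeYang1952, Appendix II] -/
def thrB (a : ℝ) (d : ℕ) (k : ℕ) : ℝ :=
  if k = 1 then (a ^ 2)⁻¹ else boost a (thrR a d (k - 1)) ^ (2 * k)

/-- `thrR a d k = max a (1 - (1 - (thrB a d k)⁻¹)/(2·2(d-k)))` for `k ≥ 1`. [folklore] -/
theorem thrR_eq (a : ℝ) (d : ℕ) {k : ℕ} (hk : 1 ≤ k) :
    thrR a d k = max a (1 - (1 - (thrB a d k)⁻¹) / (2 * (2 * ((d - k : ℕ) : ℝ)))) := by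
  obtain ⟨j, rfl⟩ : ∃ j, k = j + 1 := ⟨k - 1, by omega⟩
  rcases j with _ | j
  · simp [thrR, thrB]
  · rw [thrR, thrB, if_neg (by omega)]
    rfl

/-- **The level radii** `thrRad a d k = B_k · (thrR a d k)^{2(d-k)}`: the activity factor a
type-`k` site can afford. [cite: LeeYang1952, Appendix II] -/
def thrRad (a : ℝ) (d : ℕ) (k : ℕ) : ℝ := thrB a d k * thrR a d k ^ (2 * (d - k))

/-- **The uniform radius** `thrMin a d = min_{1 ≤ k ≤ d} thrRad a d k`. [cite: LeeYang1952, Appendix II] -/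
def thrMin (a : ℝ) (d : ℕ) : ℝ :=
  (insert 1 (Finset.Icc 1 d)).inf' (Finset.insert_nonempty _ _) (thrRad a d)

section Thresholds

variable {a : ℝ} (ha0 : 0 < a) (ha1 : a < 1)
include ha0 ha1

/-- `a ≤ thrR a d k ≤ 1` (by induction, each level's gain being `≥ 1`). [folklore] -/
theorem thrR_mem (d k : ℕ) : a ≤ thrR a d k ∧ thrR a d k ≤ 1 := by
  induction k using Nat.strong_induction_on with
  | _ k ih =>
    rcases k with _ | k
    · exact ⟨by simp [thrR]; exact ha1.le, by simp [thrR]⟩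
    · rw [thrR_eq a d (by omega : 1 ≤ k + 1)]
      refine ⟨le_max_left _ _, max_le ha1.le ?_⟩
      have hBge : 1 ≤ thrB a d (k + 1) := by
        unfold thrB
        split_ifs with h1
        · rw [one_le_inv₀ (by positivity)]
          nlinarith
        · have hr := ih k (by omega)
          simp only [Nat.add_sub_cancel]
          exact one_le_pow₀ (one_le_boost ha0.le ha1.le (lt_of_lt_of_le ha0 hr.1) hr.2)
      have hnum : 0 ≤ 1 - (thrB a d (k + 1))⁻¹ := by
        rw [sub_nonneg]
        exact inv_le_one_of_one_le₀ hBge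
      have : 0 ≤ (1 - (thrB a d (k + 1))⁻¹) / (2 * (2 * ((d - (k + 1) : ℕ) : ℝ))) :=
        div_nonneg hnum (by positivity)
      linarith

/-- `0 < thrR a d k`. [folklore] -/
theorem thrR_pos (d k : ℕ) : 0 < thrR a d k := lt_of_lt_of_le ha0 (thrR_mem ha0 ha1 d k).1

/-- `a · boost(a, thrR a d k) ≤ 1` (a missing lower neighbour's activity factor `a` absorbs the
lost boost). [folklore] -/
theorem mul_boost_thrR_le_one (d k : ℕ) : a * boost a (thrR a d k) ≤ 1 :=
  mul_boost_le_one ha0.le (thrR_pos ha0 ha1 d k) (thrR_mem ha0 ha1 d k).2 (thrR_mem ha0 ha1 d k).1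

/-- Below the top level the gains are `> 1` and the radii `< 1`. [folklore] -/
theorem one_lt_thrB_and_thrR_lt_one {d : ℕ} :
    ∀ k, 1 ≤ k → k + 1 ≤ d → 1 < thrB a d k ∧ thrR a d k < 1 := by
  intro k
  induction k with
  | zero => intro h; omega
  | succ k ih =>
    intro hk1 hkd
    have hB : 1 < thrB a d (k + 1) := by
      unfold thrB
      split_ifs with h1
      · rw [one_lt_inv₀ (by positivity)]
        nlinarith
      · have hk : 1 ≤ k := by omega
        have := ih hk (by omega)
        simp only [Nat.add_sub_cancel]
        exact one_lt_pow₀ (one_lt_boost ha0.le ha1 (thrR_pos ha0 ha1 d k) this.2) (by omega)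
    refine ⟨hB, ?_⟩
    rw [thrR_eq a d (by omega : 1 ≤ k + 1)]
    refine max_lt ha1 ?_
    have hnum : 0 < 1 - (thrB a d (k + 1))⁻¹ := by
      rw [sub_pos]
      exact inv_lt_one_of_one_lt₀ hB
    have hden : 0 < 2 * (2 * ((d - (k + 1) : ℕ) : ℝ)) := by
      have : (1 : ℝ) ≤ ((d - (k + 1) : ℕ) : ℝ) := by
        have : 1 ≤ d - (k + 1) := by omega
        exact_mod_cast this
      positivity
    have := div_pos hnum hden
    linarith

/-- **Every level radius exceeds `1`** (`2 ≤ d`, `1 ≤ k ≤ d`). [folklore] -/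
theorem one_lt_thrRad {d : ℕ} (hd : 2 ≤ d) {k : ℕ} (hk1 : 1 ≤ k) (hkd : k ≤ d) :
    1 < thrRad a d k := by
  unfold thrRad
  rcases Nat.lt_or_ge k d with hlt | hge
  · -- below the top: Bernoulli
    obtain ⟨hB, -⟩ := one_lt_thrB_and_thrR_lt_one ha0 ha1 k hk1 hlt
    refine one_lt_mul_pow_of_bernoulli hB (by omega) ?_
    rw [thrR_eq a d hk1]
    have : (2 * ((d - k : ℕ) : ℝ)) = ((2 * (d - k) : ℕ) : ℝ) := by push_cast; ring
    rw [this]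
    exact le_max_right _ _
  · -- the top level `k = d`: no outgoing bonds, the gain alone
    have hkd' : k = d := le_antisymm hkd hge
    subst hkd'
    simp only [Nat.sub_self, mul_zero, pow_zero, mul_one]
    unfold thrB
    rw [if_neg (by omega)]
    have hprev := one_lt_thrB_and_thrR_lt_one ha0 ha1 (d := k) (k - 1) (by omega) (by omega)
    exact one_lt_pow₀ (one_lt_boost ha0.le ha1 (thrR_pos ha0 ha1 k (k - 1)) hprev.2) (by omega)

omit ha0 ha1 in
/-- `thrMin a d ≤ thrRad a d k` for `1 ≤ k ≤ d`. [folklore] -/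
theorem thrMin_le {d k : ℕ} (hk1 : 1 ≤ k) (hkd : k ≤ d) : thrMin a d ≤ thrRad a d k :=
  Finset.inf'_le _ (Finset.mem_insert_of_mem (Finset.mem_Icc.2 ⟨hk1, hkd⟩))

/-- **The uniform radius exceeds `1`** (`2 ≤ d`). [folklore] -/
theorem one_lt_thrMin {d : ℕ} (hd : 2 ≤ d) : 1 < thrMin a d := by
  unfold thrMin
  rw [Finset.lt_inf'_iff]
  intro k hk
  rcases Finset.mem_insert.1 hk with rfl | hk
  · exact one_lt_thrRad ha0 ha1 hd le_rfl (by omega)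
  · exact one_lt_thrRad ha0 ha1 hd (Finset.mem_Icc.1 hk).1 (Finset.mem_Icc.1 hk).2

end Thresholds

end Literature.Barriers.CriticalPhenomena.NonGibbs

end
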